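import Summits.Ventures.DiscreteObjects.PP12.OrderElevenCollineation
import Summits.Ventures.DiscreteObjects.PP12.TwoThreeGroupReduction

/-!
# PP(12), order-11 cell, Case B: the incidence structure built from valid `TriangleData 11` (kernel; definitions for the converse)
Framing: lottery ticket; floor = certified bounds/negative ranges.

Cell pub-namedobj (venture DiscreteObjects), target (M), designs gen 16. Converse of `OrderElevenTriangleValid` (plane ⇒ valid `TriangleData 11`),
part 1: from `D : TriangleData 11` (`OrderElevenCollineation`, FAMILY-B1P §3) we define the incidence structure that a plane with a
triangle-fixing collineation `σ` of order 11 must be (semantics of `OrderElevenTriangleFrame`):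
* points `VPt D`: vertices `vx k` (`k : Fin 3`), side points `sp k x` (`σ^x Q_k ∈ S_k`), free points `fr t x` (`σ^x P_t`);
  lines `VLn D`: sides `sd k` (`S_k`, opposite `v_k`), pencil lines `pl k y` (`σ^y M_k`), free lines `fl s y` (`σ^y B_s`);
* pencil offsets `poff k t = 0, t, phi t` (`σ^{y + poff k t} P_t ∈ σ^y M_k`) and side positions `goff k s = 0, g1 s, g2 s`
  (`σ^{y + goff k s} Q_k ∈ σ^y B_s`); incidence `VPt.Inc` (table in the docstrings below), as `Membership`;
* the conditions of `TriangleData.Valid` unpacked uniformly in `k` (`partK`), and the two bijections of (Φ) (`exists_phi_eq`, `exists_sub_phi_eq`).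
Part 2 (`OrderElevenTriangleLiftPlane`): two distinct lines meet exactly once, the projective plane of order 12, the shift collineation, and
`NoCollineationOfOrderEleven ↔ NoOrderElevenOrder12`. Nothing here asserts any census statement. No `sorry`, no new axioms.
-/

namespace Summit.Ventures.DiscreteObjects.PP12

open Configuration Finset

namespace TriLift11

/-- points of the structure built from triangle data -/
inductive VPt (D : TriangleData 11) : Type
  | vx (k : Fin 3)
  | sp (k : Fin 3) (x : Fin 11)
  | fr (t : Fin 11) (x : Fin 11)
  deriving DecidableEq

/-- lines of the structure built from triangle data -/
inductive VLn (D : TriangleData 11) : Type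
  | sd (k : Fin 3)
  | pl (k : Fin 3) (y : Fin 11)
  | fl (s : Fin 11) (y : Fin 11)
  deriving DecidableEq

variable {D : TriangleData 11}

/-- pencil offsets: the free points of `σ^y M_k` are the `σ^{y + poff k t} P_t` -/
def poff (D : TriangleData 11) (k : Fin 3) (t : Fin 11) : Fin 11 := if k = 0 then 0 else if k = 1 then t else D.phi t

/-- side positions: `σ^y B_s` meets `S_k` in `σ^{y + goff k s} Q_k` -/
def goff (D : TriangleData 11) (k : Fin 3) (s : Fin 11) : Fin 11 := if k = 0 then 0 else if k = 1 then D.g1 s else D.g2 s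

/-- incidence -/
def VPt.Inc : VPt D → VLn D → Prop
  | .vx k, .sd k' => k ≠ k'
  | .vx k, .pl k' _ => k = k'
  | .vx _, .fl _ _ => False
  | .sp k _, .sd k' => k = k'
  | .sp k x, .pl k' y => k = k' ∧ x = y
  | .sp k x, .fl s y => x = y + goff D k s
  | .fr _ _, .sd _ => False
  | .fr t x, .pl k y => x = y + poff D k t
  | .fr t x, .fl s y => D.mem s t (x - y) = true

/-- incidence as membership -/
instance : Membership (VPt D) (VLn D) := ⟨fun m p => VPt.Inc p m⟩

/-- `v_k ∈ S_k' ↔ k ≠ k'` -/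
@[simp] theorem vx_mem_sd {k k' : Fin 3} : (VPt.vx k : VPt D) ∈ (VLn.sd k' : VLn D) ↔ k ≠ k' := Iff.rfl
/-- `v_k ∈ σ^y M_k' ↔ k = k'` -/
@[simp] theorem vx_mem_pl {k k' : Fin 3} {y : Fin 11} : (VPt.vx k : VPt D) ∈ (VLn.pl k' y : VLn D) ↔ k = k' := Iff.rfl
/-- vertices are off the free lines -/
@[simp] theorem vx_mem_fl {k : Fin 3} {s y : Fin 11} : (VPt.vx k : VPt D) ∈ (VLn.fl s y : VLn D) ↔ False := Iff.rfl
/-- `σ^x Q_k ∈ S_k' ↔ k = k'` -/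
@[simp] theorem sp_mem_sd {k k' : Fin 3} {x : Fin 11} : (VPt.sp k x : VPt D) ∈ (VLn.sd k' : VLn D) ↔ k = k' := Iff.rfl
/-- `σ^x Q_k ∈ σ^y M_k' ↔ k = k' ∧ x = y` -/
@[simp] theorem sp_mem_pl {k k' : Fin 3} {x y : Fin 11} : (VPt.sp k x : VPt D) ∈ (VLn.pl k' y : VLn D) ↔ k = k' ∧ x = y := Iff.rfl
/-- `σ^x Q_k ∈ σ^y B_s ↔ x = y + goff k s` -/
@[simp] theorem sp_mem_fl {k : Fin 3} {x s y : Fin 11} : (VPt.sp k x : VPt D) ∈ (VLn.fl s y : VLn D) ↔ x = y + goff D k s := Iff.rfl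
/-- free points are off the sides -/
@[simp] theorem fr_mem_sd {t x : Fin 11} {k : Fin 3} : (VPt.fr t x : VPt D) ∈ (VLn.sd k : VLn D) ↔ False := Iff.rfl
/-- `σ^x P_t ∈ σ^y M_k ↔ x = y + poff k t` -/
@[simp] theorem fr_mem_pl {t x : Fin 11} {k : Fin 3} {y : Fin 11} : (VPt.fr t x : VPt D) ∈ (VLn.pl k y : VLn D) ↔ x = y + poff D k t :=
  Iff.rfl
/-- `σ^x P_t ∈ σ^y B_s ↔ mem s t (x − y)` -/
@[simp] theorem fr_mem_fl {t x s y : Fin 11} : (VPt.fr t x : VPt D) ∈ (VLn.fl s y : VLn D) ↔ D.mem s t (x - y) = true := Iff.rfl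

/-! ### Small facts about `Fin 3` and the offsets -/

/-- `poff 0 = 0` -/
@[simp] theorem poff_zero (t : Fin 11) : poff D 0 t = 0 := rfl
/-- `poff 1 t = t` -/
@[simp] theorem poff_one (t : Fin 11) : poff D 1 t = t := rfl
/-- `poff 2 t = phi t` -/
@[simp] theorem poff_two (t : Fin 11) : poff D 2 t = D.phi t := rfl
/-- `goff 0 = 0` -/
@[simp] theorem goff_zero (s : Fin 11) : goff D 0 s = 0 := rfl
/-- `goff 1 = g1` -/
@[simp] theorem goff_one (s : Fin 11) : goff D 1 s = D.g1 s := rfl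
/-- `goff 2 = g2` -/
@[simp] theorem goff_two (s : Fin 11) : goff D 2 s = D.g2 s := rfl

/-- the third element of `Fin 3` -/
theorem fin3_third (k k' : Fin 3) (h : k ≠ k') : ∃ m : Fin 3, m ≠ k ∧ m ≠ k' ∧ ∀ m' : Fin 3, m' ≠ k → m' ≠ k' → m' = m := by
  fin_cases k <;> fin_cases k' <;> simp (config := {decide := true}) at h ⊢

/-! ### Consequences of `Valid` -/

section Valid

/-- **(K) uniformly in the pencil index:** the cells `E_{s,t} − poff k t` partition `Z₁₁ ∖ {goff k s}` -/
theorem partK (hD : D.Valid) (k : Fin 3) (s : Fin 11) :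
    (∀ t, D.mem s t (goff D k s + poff D k t) = false) ∧
    ∀ z : Fin 11, z ≠ goff D k s → ∃ t, D.mem s t (z + poff D k t) = true ∧ ∀ t', D.mem s t' (z + poff D k t') = true → t' = t := by
  obtain ⟨h0, h1, h2, -⟩ := hD.2.1 s
  fin_cases k
  · exact h0
  · exact h1
  · exact h2

/-- (K): uniqueness of the free point of `σ^y M_k` on `σ^{y'} B_s`, any residue -/
theorem partK_unique (hD : D.Valid) (k : Fin 3) (s : Fin 11) {z : Fin 11} {t t' : Fin 11} (h : D.mem s t (z + poff D k t) = true)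
    (h' : D.mem s t' (z + poff D k t') = true) : t = t' := by
  by_cases hz : z = goff D k s
  · subst hz; rw [(partK hD k s).1 t] at h; exact absurd h (by simp)
  · obtain ⟨t₀, -, huniq⟩ := (partK hD k s).2 z hz
    exact (huniq t h).trans (huniq t' h').symm

/-- (Φ): `phi` is a bijection -/
theorem exists_phi_eq (hD : D.Valid) (v : Fin 11) : ∃ t, D.phi t = v ∧ ∀ t', D.phi t' = v → t' = t := by
  have hinj : Function.Injective D.phi := fun t t' h => hD.1.1 t t' h
  obtain ⟨t, ht⟩ := hinj.surjective_of_finite (Equiv.refl _) v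
  exact ⟨t, ht, fun t' ht' => hinj (ht'.trans ht.symm)⟩

/-- (Φ): `t ↦ t − phi t` is a bijection -/
theorem exists_sub_phi_eq (hD : D.Valid) (v : Fin 11) : ∃ t, t - D.phi t = v ∧ ∀ t', t' - D.phi t' = v → t' = t := by
  have hinj : Function.Injective fun t => t - D.phi t := fun t t' h => hD.1.2 t t' h
  obtain ⟨t, ht⟩ := hinj.surjective_of_finite (Equiv.refl _) v
  exact ⟨t, ht, fun t' ht' => hinj (ht'.trans ht.symm)⟩

/-- (D): existence -/
theorem exists_internal (hD : D.Valid) (s : Fin 11) {δ : Fin 11} (hδ : δ ≠ 0) : ∃ t x, D.mem s t x = true ∧ D.mem s t (x - δ) = true := by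
  obtain ⟨t, x, h1, h2, -⟩ := (hD.2.1 s).2.2.2 δ hδ
  exact ⟨t, x, h1, h2⟩

/-- (D): uniqueness -/
theorem internal_unique (hD : D.Valid) (s : Fin 11) {δ : Fin 11} (hδ : δ ≠ 0) {t t' x x' : Fin 11} (h1 : D.mem s t x = true)
    (h2 : D.mem s t (x - δ) = true) (h1' : D.mem s t' x' = true) (h2' : D.mem s t' (x' - δ) = true) : t = t' ∧ x = x' := by
  obtain ⟨t₀, x₀, -, -, huniq⟩ := (hD.2.1 s).2.2.2 δ hδ
  obtain ⟨e1, e2⟩ := huniq t x h1 h2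
  obtain ⟨e1', e2'⟩ := huniq t' x' h1' h2'
  exact ⟨e1.trans e1'.symm, e2.trans e2'.symm⟩

/-- (X): the side positions of different free base lines differ -/
theorem goff_ne (hD : D.Valid) {s s' : Fin 11} (hss' : s ≠ s') {k : Fin 3} (hk : k ≠ 0) : goff D k s ≠ goff D k s' := by
  have X := hD.2.2 s s' hss'
  fin_cases k
  · exact absurd rfl hk
  · exact X.1
  · exact X.2.1

/-- (X): no common free point of `B_s`, `B_{s'}` -/
theorem pairNone_zero (hD : D.Valid) {s s' : Fin 11} (hss' : s ≠ s') (t x : Fin 11) : ¬ (D.mem s t x = true ∧ D.mem s' t x = true) := by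
  have h := (hD.2.2 s s' hss').2.2.1 t x
  rwa [sub_zero] at h

/-- (X): the trichotomy for `δ ≠ 0` -/
theorem cross_trichotomy (hD : D.Valid) {s s' : Fin 11} (hss' : s ≠ s') {δ : Fin 11} (hδ : δ ≠ 0) :
    (D.g1 s - D.g1 s' = δ ∧ D.g2 s - D.g2 s' ≠ δ ∧ D.PairNone s s' δ) ∨
    (D.g1 s - D.g1 s' ≠ δ ∧ D.g2 s - D.g2 s' = δ ∧ D.PairNone s s' δ) ∨
    (D.g1 s - D.g1 s' ≠ δ ∧ D.g2 s - D.g2 s' ≠ δ ∧ D.PairOne s s' δ) :=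
  (hD.2.2 s s' hss').2.2.2 δ hδ

end Valid

end TriLift11

end Summit.Ventures.DiscreteObjects.PP12
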